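import Mathlib
import HarnessLib
import Summits.Ventures.LatticeQCDFlow.Exactness.SphereKickSweep

/-!
# The Jacobian of the Engel–Schaefer LO sweep is positive almost everywhere

HONEST FRAMING: exact (Metropolis-corrected) sampling algorithms for lattice gauge theory;
figures of merit are autocorrelation/cost numbers at stated couplings and volumes; no
continuum-physics claim.

Venture `LatticeQCDFlow` (cell pub-lqcd), topic `Exactness`; FANOUT row 7 (`s0-cpn-null`: the
S0-D1 rung — THMC through the checkerboard sweep of LO site kicks).  NEW WORK of the cell over
GEN-5's `SphereKickSweep.lean` (`classKick`, `classJac`, `hasJacobian_classKick`,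
`classJac_nonneg`), `Scaling/EntropyBudgetCoupling.lean` (`coupleFun`, `coupleJac`,
`hasJacobian_coupleFun`), `CheckerboardSweep.lean` (`sweepJac`), `KickAngleMap.lean`
(`kickAngle_mem_Ioo`) and Mathlib (`Measure.toSphere_apply'`, `Measure.addHaar_submodule`,
`Measure.pi_eval_preimage_null`, `measurePreserving_piEquivPiSubtypeProd`, `angle_eq_zero_iff` /
`angle_eq_pi_iff`).  Nothing is cited as a fact.  Printed counterpart, NAMED ONLY: Engel–Schaefer,
Comput. Phys. Commun. 182 (2011) 2107, §3 eq. (18).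

Why.  GEN-6's lattice THMC theorem (`SphereLatticeHMCExact.lattice_sphere_thmc_config_exact`)
takes a field transformation with Jacobian POSITIVE EVERYWHERE (it runs HMC for `S ∘ F − log J`);
GEN-5's sweep (`kickSweepEquiv`) has the exact Jacobian `sweepJac ≥ 0` whose printed site factor
`kickJac κ n θ' = (1 − κ cos θ')(sin θ̃/sin θ')^n` VANISHES at the poles `θ' ∈ {0, π}` (a division
by zero read as `0`).  This file shows that is all that happens and that it happens on a null
set: `sweepJac > 0` almost everywhere for `⊗ μ.toSphere` — the input of the end-to-end theorem
`SphereSweepTHMCExact.lean`.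

## Content

* §1 `kickJac_pos_of_abs_le_one` — the factor is positive on `(0, π)` for `|κ| ≤ 1` (the tree's
  `kickJac_pos` asks `|κ| < 1`).
* §2 `toSphere_coe_eq_null` — a point of the sphere is `toSphere`-null (`dim ≥ 2`: its cone lies
  in a line, `addHaar_submodule`); `angle_mem_Ioo_of_ne`, **`classJac_pos_of_ne`** — the site
  factor is positive off the two poles `±J/‖J‖` of the local field.
* §3 **`pi_coupleJac_eq_zero_null`** — for a coupling layer whose site factors vanish only on
  null "bad sets" depending measurably on the frozen sites, `{coupleJac = 0}` is null for the
  product measure (Fubini over the active/frozen split, `pi_eval_preimage_null`).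
* §4 `null_preimage_of_hasJacobian` (a map with a Jacobian positive off a null set pulls null
  sets back to null sets), **`pi_sweepJac_eq_zero_null`** (two layers).
* §5 `poles`, `toSphere_poles_null`, `measurableSet_poleCylinder`, `pi_classJac_eq_zero_null`,
  **`ae_sweepJac_pos`** (the E–S sweep's Jacobian is a.e. positive), `measurable_esSweepJac`.

NOT CLAIMED: positivity everywhere (false at the poles as printed); anything quantitative.
-/

noncomputable section

namespace Summit.Ventures.LatticeQCDFlow.Exactness

open MeasureTheory Measure Metric Set Real ProbabilityTheory InnerProductGeometry
open Summit.Ventures.LatticeQCDFlow.Theory2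
open scoped ENNReal InnerProductSpace Pointwise

/-! ## §1 The eq. (18) factor is positive off the poles for `|κ| ≤ 1` -/

/-- `kickJac κ m θ > 0` for `θ ∈ (0, π)` and `|κ| ≤ 1` (both printed factors positive; the tree's
`kickJac_pos` asks `|κ| < 1`). -/
theorem kickJac_pos_of_abs_le_one {κ : ℝ} (hκ : |κ| ≤ 1) (m : ℕ) {θ : ℝ} (hθ : θ ∈ Ioo 0 π) :
    0 < kickJac κ m θ := by
  have hsin : 0 < Real.sin θ := sin_pos_of_pos_of_lt_pi hθ.1 hθ.2
  have hcos : |Real.cos θ| < 1 := by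
    have h1 : Real.cos θ ^ 2 < 1 := by nlinarith [Real.sin_sq_add_cos_sq θ]
    have h2 : |Real.cos θ| ^ 2 < 1 := by rwa [sq_abs]
    nlinarith [abs_nonneg (Real.cos θ)]
  have h1 : 0 < 1 - κ * Real.cos θ := by
    have : κ * Real.cos θ ≤ |κ| * |Real.cos θ| := by
      rw [← abs_mul]; exact le_abs_self _
    nlinarith [abs_nonneg κ, abs_nonneg (Real.cos θ)]
  have hθ' := kickAngle_mem_Ioo hκ hθ
  have h2 : 0 < Real.sin (kickAngle κ θ) / Real.sin θ :=
    div_pos (sin_pos_of_pos_of_lt_pi hθ'.1 hθ'.2) hsin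
  unfold kickJac
  exact mul_pos h1 (pow_pos h2 m)

/-! ## §2 One sphere: points are null; the site factor vanishes only at the poles `±Ĵ` -/

section OneSphere

variable {V : Type*} [NormedAddCommGroup V] [InnerProductSpace ℝ V] [FiniteDimensional ℝ V]
  [MeasurableSpace V] [BorelSpace V]

/-- **A point of the sphere is `toSphere`-null** (`dim V ≥ 2`): its cone is inside a line. -/
theorem toSphere_coe_eq_null (μ : Measure V) [μ.IsAddHaarMeasure] (h2 : 2 ≤ Module.finrank ℝ V)
    (v : V) : μ.toSphere {g : sphere (0 : V) 1 | (g : V) = v} = 0 := by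
  have hs : MeasurableSet {g : sphere (0 : V) 1 | (g : V) = v} :=
    measurableSet_eq_fun continuous_subtype_val.measurable measurable_const
  rw [Measure.toSphere_apply' _ hs]
  have hsub : Ioo (0 : ℝ) 1 • ((↑) '' {g : sphere (0 : V) 1 | (g : V) = v} : Set V) ⊆
      (Submodule.span ℝ {v} : Set V) := by
    rintro x ⟨r, -, w, ⟨g, hg, rfl⟩, rfl⟩
    rw [Set.mem_setOf_eq] at hg
    rw [hg]
    exact Submodule.smul_mem _ _ (Submodule.subset_span rfl)
  have hne : (Submodule.span ℝ {v} : Submodule ℝ V) ≠ ⊤ := by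
    intro htop
    have h1 : Module.finrank ℝ (Submodule.span ℝ ({v} : Set V)) ≤ 1 := by
      simpa using finrank_span_le_card ({v} : Set V)
    rw [htop, finrank_top] at h1
    omega
  have h0 : μ (Ioo (0 : ℝ) 1 • ((↑) '' {g : sphere (0 : V) 1 | (g : V) = v} : Set V)) = 0 :=
    measure_mono_null hsub (Measure.addHaar_submodule μ _ hne)
  rw [h0, mul_zero]

omit [FiniteDimensional ℝ V] [MeasurableSpace V] [BorelSpace V] in
/-- Off the two poles `±J/‖J‖` the angle to `J` lies in `(0, π)`. -/
theorem angle_mem_Ioo_of_ne {J : V} {g : sphere (0 : V) 1} (h₁ : (g : V) ≠ ‖J‖⁻¹ • J)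
    (h₂ : (g : V) ≠ -(‖J‖⁻¹ • J)) : angle J (g : V) ∈ Ioo 0 π := by
  have hg : ‖(g : V)‖ = 1 := norm_eq_of_mem_sphere g
  refine ⟨lt_of_le_of_ne (angle_nonneg _ _) (fun h => ?_), lt_of_le_of_ne (angle_le_pi _ _) (fun h => ?_)⟩
  · obtain ⟨hJ, r, hr, hgr⟩ := angle_eq_zero_iff.1 h.symm
    apply h₁
    have hr' : r = ‖J‖⁻¹ := by
      have := congrArg norm hgr
      rw [hg, norm_smul, Real.norm_eq_abs, abs_of_pos hr] at this
      field_simp [norm_ne_zero_iff.2 hJ] at this ⊢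
      linarith
    rw [hgr, hr']
  · obtain ⟨hJ, r, hr, hgr⟩ := angle_eq_pi_iff.1 h
    apply h₂
    have hr' : r = -‖J‖⁻¹ := by
      have := congrArg norm hgr
      rw [hg, norm_smul, Real.norm_eq_abs, abs_of_neg hr] at this
      field_simp [norm_ne_zero_iff.2 hJ] at this ⊢
      linarith
    rw [hgr, hr', neg_smul]

variable (n : ℕ) (c : ℝ) {ι : Type*} {p : ι → Prop} (L : SiteLocalField V c p)

omit [FiniteDimensional ℝ V] [MeasurableSpace V] [BorelSpace V] in
/-- **The site factor of the E–S sweep is positive off the poles** `±Ĵ` of the local field. -/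
theorem classJac_pos_of_ne (a : {i // p i}) (y : {i // ¬p i} → sphere (0 : V) 1)
    (g : sphere (0 : V) 1) (h₁ : (g : V) ≠ ‖L.J a y‖⁻¹ • L.J a y)
    (h₂ : (g : V) ≠ -(‖L.J a y‖⁻¹ • L.J a y)) : 0 < classJac n c L a y g := by
  have hκ : |c * ‖L.J a y‖| ≤ 1 := by
    rw [abs_mul, abs_norm]; exact L.norm_le a y
  exact kickJac_pos_of_abs_le_one hκ n (angle_mem_Ioo_of_ne h₁ h₂)

end OneSphere

/-! ## §3 A coupling layer: `{coupleJac = 0}` is null -/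

section Couple

variable {ι : Type*} [Fintype ι] {p : ι → Prop} [DecidablePred p] {G : Type*} [MeasurableSpace G]
  (m : Measure G) [SigmaFinite m]

/-- **`{coupleJac = 0}` is null** when each site factor vanishes only on a null "bad set" that
depends measurably on the frozen sites (Fubini over the active/frozen split). -/
theorem pi_coupleJac_eq_zero_null {j : {i // p i} → ({i // ¬p i} → G) → G → ℝ}
    (bad : {i // p i} → ({i // ¬p i} → G) → Set G)
    (hbad : ∀ a y, m (bad a y) = 0)
    (hC : ∀ a, MeasurableSet {z : ({i // p i} → G) × ({i // ¬p i} → G) | z.1 a ∈ bad a z.2})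
    (hj : ∀ a y g, g ∉ bad a y → j a y g ≠ 0) :
    Measure.pi (fun _ : ι => m) {U | coupleJac p j U = 0} = 0 := by
  have he_mp := measurePreserving_piEquivPiSubtypeProd (fun _ : ι => m) p
  -- the zero set is inside the union of the sites' bad cylinders
  have hsub : {U : ι → G | coupleJac p j U = 0} ⊆
      ⋃ a : {i // p i}, (MeasurableEquiv.piEquivPiSubtypeProd (fun _ : ι => G) p) ⁻¹'
        {z | z.1 a ∈ bad a z.2} := by
    intro U hU
    rw [Set.mem_setOf_eq, coupleJac, Finset.prod_eq_zero_iff] at hU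
    obtain ⟨a, -, ha⟩ := hU
    refine Set.mem_iUnion.2 ⟨a, ?_⟩
    rw [Set.mem_preimage, Set.mem_setOf_eq]
    by_contra hnot
    exact hj a _ _ hnot ha
  refine measure_mono_null hsub ((measure_iUnion_null_iff).2 fun a => ?_)
  rw [he_mp.measure_preimage (hC a).nullMeasurableSet, Measure.prod_apply_symm (hC a)]
  refine lintegral_eq_zero_of_ae_eq_zero (ae_of_all _ fun y => ?_)  -- pointwise zero sections
  change Measure.pi (fun _ : {i // p i} => m) ((fun x : {i // p i} → G => (x, y)) ⁻¹' {z | z.1 a ∈ bad a z.2}) = 0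
  have : (fun x : {i // p i} → G => (x, y)) ⁻¹' {z : ({i // p i} → G) × ({i // ¬p i} → G) | z.1 a ∈ bad a z.2} =
      Function.eval a ⁻¹' bad a y := by
    ext x; simp
  rw [this]
  exact Measure.pi_eval_preimage_null (fun _ : {i // p i} => m) (hbad a y)

end Couple

/-! ## §4 A two-class sweep: `{sweepJac = 0}` is null -/

section Sweep

variable {ι : Type*} [Fintype ι] {p q : ι → Prop} [DecidablePred p] [DecidablePred q] {G : Type*}
  [MeasurableSpace G] (m : Measure G) [SigmaFinite m]

/-- **Preimages of null sets under a map with a Jacobian positive off a null set are null.** -/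
theorem null_preimage_of_hasJacobian {Ω : Type*} [MeasurableSpace Ω] {ν : Measure Ω} {F : Ω → Ω}
    {J : Ω → ℝ≥0∞} (hF : HasJacobian ν F J) (hJ : ν {x | J x = 0} = 0) {A : Set Ω} (hA : ν A = 0) :
    ν (F ⁻¹' A) = 0 := by
  set B := toMeasurable ν A with hB
  have hBm : MeasurableSet B := measurableSet_toMeasurable ν A
  have hB0 : ν B = 0 := by rw [hB, measure_toMeasurable]; exact hA
  have hpre : MeasurableSet (F ⁻¹' B) := hF.measurable hBm
  -- the `J`-weighted measure of the preimage vanishes …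
  have h1 : (ν.withDensity J) (F ⁻¹' B) = 0 := by
    rw [← Measure.map_apply hF.measurable hBm, hF.map_eq, hB0]
  rw [withDensity_apply _ hpre, lintegral_eq_zero_iff hF.measurable_jac] at h1
  -- … so `J = 0` a.e. on it
  have h3 : ∀ᵐ x ∂ν, x ∈ F ⁻¹' B → J x = 0 := (ae_restrict_iff' hpre).1 h1
  have h2 : ν {x | x ∈ F ⁻¹' B ∧ J x ≠ 0} = 0 := by
    rw [measure_eq_zero_iff_ae_notMem]
    filter_upwards [h3] with x hx hmem
    exact hmem.2 (hx hmem.1)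
  have hsub : F ⁻¹' A ⊆ {x | J x = 0} ∪ {x | x ∈ F ⁻¹' B ∧ J x ≠ 0} := by
    intro x hx
    have hxB : x ∈ F ⁻¹' B := subset_toMeasurable ν A hx
    by_cases hJx : J x = 0
    · exact Or.inl hJx
    · exact Or.inr ⟨hxB, hJx⟩
  exact measure_mono_null hsub (measure_union_null hJ h2)

omit [SigmaFinite m] in
/-- **`{sweepJac = 0}` is null** for a two-class sweep whose layers' zero sets are null: the second
layer's zero set is pulled back through the first layer (`null_preimage_of_hasJacobian`). -/
theorem pi_sweepJac_eq_zero_null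
    {ψ₁ : {i // p i} → ({i // ¬p i} → G) → G → G} {j₁ : {i // p i} → ({i // ¬p i} → G) → G → ℝ}
    {j₂ : {i // q i} → ({i // ¬q i} → G) → G → ℝ}
    (hG₁ : HasJacobian (Measure.pi fun _ : ι => m) (coupleFun p ψ₁)
      fun U => ENNReal.ofReal (coupleJac p j₁ U))
    (hj₁0 : ∀ a y g, 0 ≤ j₁ a y g)
    (hZ₁ : Measure.pi (fun _ : ι => m) {U | coupleJac p j₁ U = 0} = 0)
    (hZ₂ : Measure.pi (fun _ : ι => m) {W | coupleJac q j₂ W = 0} = 0) :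
    Measure.pi (fun _ : ι => m) {U | sweepJac p q ψ₁ j₁ j₂ U = 0} = 0 := by
  have hJ0 : Measure.pi (fun _ : ι => m) {U | ENNReal.ofReal (coupleJac p j₁ U) = 0} = 0 := by
    refine measure_mono_null (fun U hU => ?_) hZ₁
    rw [Set.mem_setOf_eq, ENNReal.ofReal_eq_zero] at hU
    exact le_antisymm hU (Finset.prod_nonneg fun a _ => hj₁0 a _ _)
  have hpre := null_preimage_of_hasJacobian hG₁ hJ0 hZ₂
  refine measure_mono_null (fun U hU => ?_) (measure_union_null hZ₁ hpre)
  rw [Set.mem_setOf_eq, sweepJac, mul_eq_zero] at hU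
  rcases hU with h | h
  · exact Or.inr h
  · exact Or.inl h

end Sweep

/-! ## §5 The E–S sweep: `sweepJac > 0` almost everywhere -/

section ES

variable (n : ℕ) {V : Type*} [NormedAddCommGroup V] [InnerProductSpace ℝ V] [FiniteDimensional ℝ V]
  [MeasurableSpace V] [BorelSpace V] (c : ℝ)
  {ι : Type*} [Fintype ι] {p q : ι → Prop} [DecidablePred p] [DecidablePred q]

/-- The two poles `±J/‖J‖` of a local field `J` on the site sphere (empty if `J = 0`). -/
def poles (J : V) : Set (sphere (0 : V) 1) :=
  {g | (g : V) = ‖J‖⁻¹ • J} ∪ {g | (g : V) = -(‖J‖⁻¹ • J)}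

omit [FiniteDimensional ℝ V] [MeasurableSpace V] [BorelSpace V] [Fintype ι] in
/-- Membership in the pole set. -/
theorem mem_poles {J : V} {g : sphere (0 : V) 1} :
    g ∈ poles J ↔ (g : V) = ‖J‖⁻¹ • J ∨ (g : V) = -(‖J‖⁻¹ • J) := Iff.rfl

omit [Fintype ι] in
/-- The poles are `toSphere`-null (`dim V ≥ 2`). -/
theorem toSphere_poles_null (μ : Measure V) [μ.IsAddHaarMeasure] (h2 : 2 ≤ Module.finrank ℝ V) (J : V) :
    μ.toSphere (poles J) = 0 :=
  measure_union_null (toSphere_coe_eq_null μ h2 _) (toSphere_coe_eq_null μ h2 _)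

omit [DecidablePred p] in
/-- The pole cylinder of an active site is a measurable subset of (active) × (frozen). -/
theorem measurableSet_poleCylinder (L : SiteLocalField V c p) (a : {i // p i}) :
    MeasurableSet {z : ({i // p i} → sphere (0 : V) 1) × ({i // ¬p i} → sphere (0 : V) 1) |
      z.1 a ∈ poles (L.J a z.2)} := by
  have hf : Measurable fun z : ({i // p i} → sphere (0 : V) 1) × ({i // ¬p i} → sphere (0 : V) 1) =>
      ((z.1 a : sphere (0 : V) 1) : V) :=
    continuous_subtype_val.measurable.comp ((measurable_pi_apply a).comp measurable_fst)
  have hu : Measurable fun z : ({i // p i} → sphere (0 : V) 1) × ({i // ¬p i} → sphere (0 : V) 1) =>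
      ‖L.J a z.2‖⁻¹ • L.J a z.2 := by
    have hJ : Measurable fun z : ({i // p i} → sphere (0 : V) 1) × ({i // ¬p i} → sphere (0 : V) 1) =>
        L.J a z.2 := (L.continuous a).measurable.comp measurable_snd
    exact hJ.norm.inv.smul hJ
  exact (measurableSet_eq_fun hf hu).union (measurableSet_eq_fun hf hu.neg)

/-- **`{coupleJac = 0}` is null for one class of E–S site kicks** (`dim V ≥ 2`). -/
theorem pi_classJac_eq_zero_null (μ : Measure V) [μ.IsAddHaarMeasure] (h2 : 2 ≤ Module.finrank ℝ V)
    (L : SiteLocalField V c p) :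
    Measure.pi (fun _ : ι => μ.toSphere) {U | coupleJac p (classJac n c L) U = 0} = 0 :=
  pi_coupleJac_eq_zero_null μ.toSphere (fun a y => poles (L.J a y))
    (fun a y => toSphere_poles_null μ h2 _) (measurableSet_poleCylinder c L)
    (fun a y g hg => by
      rw [mem_poles, not_or] at hg
      exact (classJac_pos_of_ne n c L a y g hg.1 hg.2).ne')

variable (L₁ : SiteLocalField V c p) (L₂ : SiteLocalField V c q)

/-- **The E–S sweep's Jacobian is positive almost everywhere** for `⊗ μ.toSphere`. -/
theorem ae_sweepJac_pos (hV : Module.finrank ℝ V = n + 2) (μ : Measure V) [μ.IsAddHaarMeasure] :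
    ∀ᵐ U ∂(Measure.pi fun _ : ι => μ.toSphere),
      0 < sweepJac p q (fun a y g => sphereKick c (L₁.J a y) g) (classJac n c L₁) (classJac n c L₂) U := by
  have hG₁ := hasJacobian_coupleFun (p := p) μ.toSphere (measurable_classKick n hV c L₁)
    (measurable_classJac n c L₁) (hasJacobian_classKick n hV c L₁ μ) (classJac_nonneg n c L₁)
  have h2 : 2 ≤ Module.finrank ℝ V := by rw [hV]; omega
  have hZ := pi_sweepJac_eq_zero_null (q := q) (j₂ := classJac n c L₂) μ.toSphere hG₁
    (classJac_nonneg n c L₁) (pi_classJac_eq_zero_null n c μ h2 L₁) (pi_classJac_eq_zero_null n c μ h2 L₂)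
  rw [ae_iff]
  refine measure_mono_null (fun U hU => ?_) hZ
  rw [Set.mem_setOf_eq, not_lt] at hU
  have hnn : 0 ≤ sweepJac p q (fun a y g => sphereKick c (L₁.J a y) g) (classJac n c L₁) (classJac n c L₂) U :=
    mul_nonneg (Finset.prod_nonneg fun a _ => classJac_nonneg n c L₂ _ _ _)
      (Finset.prod_nonneg fun a _ => classJac_nonneg n c L₁ _ _ _)
  exact le_antisymm hU hnn

/-- The sweep's Jacobian is a measurable function of the configuration. -/
theorem measurable_esSweepJac (hV : Module.finrank ℝ V = n + 2) :
    Measurable fun U : ι → sphere (0 : V) 1 =>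
      sweepJac p q (fun a y g => sphereKick c (L₁.J a y) g) (classJac n c L₁) (classJac n c L₂) U :=
  ((measurable_coupleJac (measurable_classJac n c L₂)).comp
    (measurable_coupleFun (measurable_classKick n hV c L₁))).mul
    (measurable_coupleJac (measurable_classJac n c L₁))

end ES


end Summit.Ventures.LatticeQCDFlow.Exactness

end
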